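import Summits.CriticalPhenomena.PercolationContinuityZ3.Theorems.PercNearOneGluingNoHeavyPcintOneDefectBridge
import HarnessLib

/-!
# CriticalPhenomena/PercolationContinuityZ3 — Theorems/PercNearOneGluingNoHeavyPcintOneDefectBridgeInv.lean: the inverse of `toCfg` — `#defectSet α = #dSet α`

Lane prim-pcint, STRUCTURE rule «numerics ⇒ structure ⇒ conjecture» (prim-pcint-2 GEN 22); sequel of …PcintOneDefectBridge.  From a configuration
of `dSet` (four letters, two positive including the least, no proper closed interval of weight zero) we rebuild the one-defect structure: pair the
two positive letters and the two negative letters into the marked chords (`ofCfg`).  `ofCfg` and `toCfg` are inverse bijections between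
`defectSet α` and `dSet α` (`card_defectSet_eq_card_dSet`).

HONEST FRAMING: elementary finite combinatorics.  No `sorry`; standard axioms.  Written by prim-pcint-2 gen 22 (prover-prim-pcint-2-g22-0), 2026-08-27.
-/

namespace Summit.CriticalPhenomena.PercolationContinuityZ3.Theorems.Pcint.ChordDiag

variable {α : Type*} [LinearOrder α] [Fintype α]

/-! ### Least and greatest elements with a default -/

/-- The least element of a finset (a default if empty). [folklore] -/
noncomputable def mnD (s : Finset α) (d : α) : α := if h : s.Nonempty then s.min' h else d

/-- The greatest element of a finset (a default if empty). [folklore] -/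
noncomputable def mxD (s : Finset α) (d : α) : α := if h : s.Nonempty then s.max' h else d

omit [Fintype α] in
/-- `mnD` of a non-empty finset is its least element. [folklore] -/
theorem mnD_eq {s : Finset α} (h : s.Nonempty) (d : α) : mnD s d = s.min' h := by simp [mnD, h]

omit [Fintype α] in
/-- `mxD` of a non-empty finset is its greatest element. [folklore] -/
theorem mxD_eq {s : Finset α} (h : s.Nonempty) (d : α) : mxD s d = s.max' h := by simp [mxD, h]

omit [Fintype α] in
/-- A two-element finset is `{min, max}` with `min < max`. [folklore] -/
theorem pair_of_card_two {s : Finset α} (h : s.card = 2) (d : α) :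
    mnD s d < mxD s d ∧ s = {mnD s d, mxD s d} := by
  obtain ⟨x, y, hxy, rfl⟩ := Finset.card_eq_two.1 h
  have hne : ({x, y} : Finset α).Nonempty := ⟨x, by simp⟩
  rw [mnD_eq hne, mxD_eq hne]
  rcases lt_or_gt_of_ne hxy with hlt | hlt
  · have hmin : ({x, y} : Finset α).min' hne = x := by
      refine le_antisymm (Finset.min'_le _ _ (by simp)) (Finset.le_min' _ _ _ fun z hz => ?_)
      simp only [Finset.mem_insert, Finset.mem_singleton] at hz; rcases hz with rfl | rfl; exacts [le_rfl, hlt.le]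
    have hmax : ({x, y} : Finset α).max' hne = y := by
      refine le_antisymm (Finset.max'_le _ _ _ fun z hz => ?_) (Finset.le_max' _ _ (by simp))
      simp only [Finset.mem_insert, Finset.mem_singleton] at hz; rcases hz with rfl | rfl; exacts [hlt.le, le_rfl]
    rw [hmin, hmax]; exact ⟨hlt, rfl⟩
  · have hmin : ({x, y} : Finset α).min' hne = y := by
      refine le_antisymm (Finset.min'_le _ _ (by simp)) (Finset.le_min' _ _ _ fun z hz => ?_)
      simp only [Finset.mem_insert, Finset.mem_singleton] at hz; rcases hz with rfl | rfl; exacts [hlt.le, le_rfl]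
    have hmax : ({x, y} : Finset α).max' hne = x := by
      refine le_antisymm (Finset.max'_le _ _ _ fun z hz => ?_) (Finset.le_max' _ _ (by simp))
      simp only [Finset.mem_insert, Finset.mem_singleton] at hz; rcases hz with rfl | rfl; exacts [le_rfl, hlt.le]
    rw [hmin, hmax]; exact ⟨hlt, Finset.pair_comm x y⟩

/-! ### From a configuration back to a one-defect structure -/

/-- The positive letters. [folklore] -/
def posL (c : Cfg α) : Finset α := (letters c).filter fun x => c.2 x = true

/-- The negative letters. [folklore] -/
def negL (c : Cfg α) : Finset α := (letters c).filter fun x => ¬c.2 x = true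

/-- The least letter. [folklore] -/
noncomputable def dA (c : Cfg α) (d : α) : α := mnD (letters c) d

/-- The other positive letter. [folklore] -/
noncomputable def dA' (c : Cfg α) (d : α) : α := mxD (posL c) d

/-- The smaller negative letter. [folklore] -/
noncomputable def dB (c : Cfg α) (d : α) : α := mnD (negL c) d

/-- The larger negative letter. [folklore] -/
noncomputable def dB' (c : Cfg α) (d : α) : α := mxD (negL c) d

/-- The one-defect structure of a configuration: pair the positive letters and the negative letters (default `d` unused on `dSet`). [folklore] -/
noncomputable def ofCfg (d : α) (c : Cfg α) : (α → α) × α × α :=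
  (fun x => if x = dA c d then dA' c d else if x = dA' c d then dA c d else if x = dB c d then dB' c d else if x = dB' c d then dB c d
    else c.1 x, dA c d, dB c d)

section OfCfg

variable {c : Cfg α} (d : α)

/-- The letter structure of a configuration of `dSet`: least letter `a`, the other positive letter `a'`, negative letters `b < b'`. [folklore] -/
theorem letters_of_isDCfg (h : IsDCfg c) :
    dA c d < dA' c d ∧ dB c d < dB' c d ∧ posL c = {dA c d, dA' c d} ∧ negL c = {dB c d, dB' c d} ∧
      letters c = {dA c d, dA' c d, dB c d, dB' c d} ∧ dA c d < dB c d ∧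
      dA c d ≠ dA' c d ∧ dB c d ≠ dB' c d ∧ dA c d ≠ dB c d ∧ dB c d ≠ dA' c d ∧ dA c d ≠ dB' c d ∧ dA' c d ≠ dB' c d := by
  obtain ⟨hc, -, h4, hP', hmin⟩ := h
  have hP : (posL c).card = 2 := hP'
  have hLne : (letters c).Nonempty := Finset.card_pos.1 (by omega)
  have hN : (negL c).card = 2 := by
    have h' := Finset.card_filter_add_card_filter_not (s := letters c) (fun x => c.2 x = true)
    change (posL c).card + (negL c).card = (letters c).card at h'
    omega
  obtain ⟨hb, hNeq⟩ := pair_of_card_two hN d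
  change dB c d < dB' c d at hb
  change negL c = {dB c d, dB' c d} at hNeq
  have haL : dA c d = (letters c).min' hLne := mnD_eq hLne d
  have hamem : dA c d ∈ letters c := haL ▸ Finset.min'_mem _ _
  have hale : ∀ y ∈ letters c, dA c d ≤ y := fun y hy => haL ▸ Finset.min'_le _ _ hy
  have hapos : c.2 (dA c d) = true := hmin _ hamem hale
  have haP : dA c d ∈ posL c := Finset.mem_filter.2 ⟨hamem, hapos⟩
  have hPne : (posL c).Nonempty := ⟨_, haP⟩
  have hmnP : mnD (posL c) d = dA c d := by
    rw [mnD_eq hPne]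
    exact le_antisymm (Finset.min'_le _ _ haP) (hale _ (Finset.mem_filter.1 (Finset.min'_mem _ hPne)).1)
  obtain ⟨haa', hPeq⟩ := pair_of_card_two hP d
  rw [hmnP] at haa' hPeq
  change dA c d < dA' c d at haa'
  change posL c = {dA c d, dA' c d} at hPeq
  have hbN : dB c d ∈ negL c := by rw [hNeq]; simp
  have hb'N : dB' c d ∈ negL c := by rw [hNeq]; simp
  have ha'P : dA' c d ∈ posL c := by rw [hPeq]; simp
  have sgn_of_P : ∀ {x}, x ∈ posL c → c.2 x = true := fun hx => (Finset.mem_filter.1 hx).2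
  have sgn_of_N : ∀ {x}, x ∈ negL c → ¬c.2 x = true := fun hx => (Finset.mem_filter.1 hx).2
  have mem_of_N : ∀ {x}, x ∈ negL c → x ∈ letters c := fun hx => (Finset.mem_filter.1 hx).1
  have hab : dA c d ≠ dB c d := fun h => sgn_of_N hbN (h ▸ hapos)
  have hab' : dA c d ≠ dB' c d := fun h => sgn_of_N hb'N (h ▸ hapos)
  have hba' : dB c d ≠ dA' c d := fun h => sgn_of_N hbN (h ▸ sgn_of_P ha'P)
  have ha'b' : dA' c d ≠ dB' c d := fun h => sgn_of_N hb'N (h ▸ sgn_of_P ha'P)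
  have hL : letters c = {dA c d, dA' c d, dB c d, dB' c d} := by
    have : letters c = posL c ∪ negL c := by
      unfold posL negL; rw [Finset.filter_union_filter_not_eq]
    rw [this, hPeq, hNeq, Finset.insert_union, ← Finset.insert_eq]
  exact ⟨haa', hb, hPeq, hNeq, hL, lt_of_le_of_ne (hale _ (mem_of_N hbN)) hab, haa'.ne, hb.ne, hab, hba', hab', ha'b'⟩

/-- The marked chords of `ofCfg`. [folklore] -/
theorem ofCfg_vals (h : IsDCfg c) :
    (ofCfg d c).2.1 = dA c d ∧ (ofCfg d c).2.2 = dB c d ∧ (ofCfg d c).1 (dA c d) = dA' c d ∧ (ofCfg d c).1 (dA' c d) = dA c d ∧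
      (ofCfg d c).1 (dB c d) = dB' c d ∧ (ofCfg d c).1 (dB' c d) = dB c d ∧ ∀ x, x ∉ letters c → (ofCfg d c).1 x = c.1 x := by
  obtain ⟨-, -, -, -, hL, -, haa', hbb', hab, hba', hab', ha'b'⟩ := letters_of_isDCfg d h
  refine ⟨rfl, rfl, by simp [ofCfg], by simp [ofCfg, haa'.symm], by simp [ofCfg, hab.symm, hba'],
    by simp [ofCfg, hab'.symm, ha'b'.symm, hbb'.symm], fun x hx => ?_⟩
  rw [hL] at hx
  simp only [Finset.mem_insert, Finset.mem_singleton, not_or] at hx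
  simp [ofCfg, hx.1, hx.2.1, hx.2.2.1, hx.2.2.2]

/-- **`ofCfg` of a configuration of `dSet` is a one-defect structure, and `toCfg` recovers the configuration.** [folklore] -/
theorem ofCfg_mem (h : IsDCfg c) : ofCfg d c ∈ defectSet α ∧ toCfg (ofCfg d c) = c := by
  obtain ⟨haa', hbb', hP, hN, hL, hab, n1, n2, n3, n4, n5, n6⟩ := letters_of_isDCfg d h
  obtain ⟨h2a, h2b, va, va', vb, vb', voff⟩ := ofCfg_vals d h
  obtain ⟨hc, hsaw, -, -, -⟩ := h
  have hlet : ∀ x, x ∈ letters c ↔ c.1 x = x := fun x => mem_letters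
  -- the map is a chord diagram
  have hdiag : IsDiag (ofCfg d c).1 := by
    intro x
    by_cases hx : x ∈ letters c
    · rw [hL] at hx
      simp only [Finset.mem_insert, Finset.mem_singleton] at hx
      rcases hx with rfl | rfl | rfl | rfl
      · rw [va, va']; exact ⟨rfl, fun h => n1 h.symm⟩
      · rw [va', va]; exact ⟨rfl, fun h => n1 h⟩
      · rw [vb, vb']; exact ⟨rfl, fun h => n2 h.symm⟩
      · rw [vb', vb]; exact ⟨rfl, fun h => n2 h⟩
    · have hx1 : c.1 x ≠ x := fun h' => hx ((hlet x).2 h')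
      have hx2 : c.1 x ∉ letters c := fun h' => by
        have := (hlet _).1 h'
        rw [hc.1] at this
        exact hx1 this.symm
      rw [voff x hx, voff (c.1 x) hx2, hc.1]
      exact ⟨rfl, hx1⟩
  have hpair : IsPair (ofCfg d c).1 (ofCfg d c).2.1 (ofCfg d c).2.2 := by
    rw [h2a, h2b]
    exact ⟨by rw [va]; exact haa', by rw [vb]; exact hbb', hab, by rw [va]; exact n4⟩
  have hquad : quad (ofCfg d c).1 (ofCfg d c).2.1 (ofCfg d c).2.2 = letters c := by
    rw [h2a, h2b, hL]; unfold quad; rw [va, vb]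
  -- `toCfg` recovers `c`
  have hback : toCfg (ofCfg d c) = c := by
    refine Prod.ext (funext fun x => ?_) (funext fun x => ?_)
    · show (toCfg ((ofCfg d c).1, (ofCfg d c).2.1, (ofCfg d c).2.2)).1 x = c.1 x
      by_cases hx : x ∈ letters c
      · rw [toCfg_fst_of_mem (hquad ▸ hx)]; exact ((hlet x).1 hx).symm
      · rw [toCfg_fst_of_not_mem (hquad ▸ hx)]; exact voff x hx
    · show (toCfg ((ofCfg d c).1, (ofCfg d c).2.1, (ofCfg d c).2.2)).2 x = c.2 x
      rw [toCfg_snd, h2a, va]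
      by_cases hx : x ∈ posL c
      · have hx' : x ∈ ({dA c d, dA' c d} : Finset α) := hP ▸ hx
        rw [Finset.mem_insert, Finset.mem_singleton] at hx'
        rw [(Finset.mem_filter.1 hx).2]
        exact decide_eq_true hx'
      · have : c.2 x = false := by
          by_cases hxl : x ∈ letters c
          · simpa [posL, hxl] using hx
          · exact hc.2 x fun h' => hxl ((hlet x).2 h')
        have hx' : x ∉ ({dA c d, dA' c d} : Finset α) := hP ▸ hx
        rw [Finset.mem_insert, Finset.mem_singleton] at hx'
        rw [this]
        exact decide_eq_false hx'
  refine ⟨mem_defectSet.2 ⟨hdiag, hpair, ?_⟩, hback⟩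
  have := (propSAW_toCfg_iff hdiag hpair).1
  rw [show (((ofCfg d c).1, (ofCfg d c).2.1, (ofCfg d c).2.2) : (α → α) × α × α) = ofCfg d c from rfl, hback] at this
  exact this hsaw

end OfCfg

/-! ### The bijection -/

/-- `ofCfg (toCfg t) = t` on `defectSet`. [folklore] -/
theorem ofCfg_toCfg (d : α) {t : (α → α) × α × α} (ht : t ∈ defectSet α) : ofCfg d (toCfg t) = t := by
  obtain ⟨π, a, b⟩ := t
  obtain ⟨hd, hp, -, -⟩ := mem_defectSet.1 ht
  dsimp only at hd hp
  obtain ⟨d1, d2, d3, d4, d5, d6⟩ := hp.distinct hd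
  have hL : letters (toCfg (π, a, b)) = quad π a b := letters_toCfg hd
  have hP : posL (toCfg (π, a, b)) = {a, π a} := filter_letters_toCfg hd hp
  have hN : negL (toCfg (π, a, b)) = {b, π b} := by
    unfold negL; rw [hL]
    ext x
    rw [Finset.mem_filter, mem_quad, toCfg_snd, decide_eq_true_eq, Finset.mem_insert, Finset.mem_singleton]
    constructor
    · rintro ⟨h1, h2⟩; push Not at h2; tauto
    · rintro (rfl | rfl)
      · exact ⟨Or.inr (Or.inr (Or.inl rfl)), fun h => h.elim d3.symm d4⟩
      · exact ⟨Or.inr (Or.inr (Or.inr rfl)), fun h => h.elim (Ne.symm d5) (Ne.symm d6)⟩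
  have hLne : (quad π a b).Nonempty := ⟨a, mem_quad.2 (Or.inl rfl)⟩
  have ha : mnD (letters (toCfg (π, a, b))) d = a := by
    rw [hL, mnD_eq hLne]
    exact le_antisymm (Finset.min'_le _ _ (mem_quad.2 (Or.inl rfl))) (Finset.le_min' _ _ _ fun y hy => le_of_mem_quad hp hy)
  have hPc : ({a, π a} : Finset α).card = 2 := Finset.card_pair d1
  have hNc : ({b, π b} : Finset α).card = 2 := Finset.card_pair d2
  obtain ⟨hlt1, heq1⟩ := pair_of_card_two hPc d
  obtain ⟨hlt2, heq2⟩ := pair_of_card_two hNc d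
  -- identify min/max of the pairs
  have hmx1 : mxD ({a, π a} : Finset α) d = π a := by
    rw [mxD_eq ⟨a, by simp⟩]
    refine le_antisymm (Finset.max'_le _ _ _ fun z hz => ?_) (Finset.le_max' _ _ (by simp))
    simp only [Finset.mem_insert, Finset.mem_singleton] at hz; rcases hz with rfl | rfl; exacts [hp.1.le, le_rfl]
  have hmn2 : mnD ({b, π b} : Finset α) d = b := by
    rw [mnD_eq ⟨b, by simp⟩]
    refine le_antisymm (Finset.min'_le _ _ (by simp)) (Finset.le_min' _ _ _ fun z hz => ?_)
    simp only [Finset.mem_insert, Finset.mem_singleton] at hz; rcases hz with rfl | rfl; exacts [le_rfl, hp.2.1.le]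
  have hmx2 : mxD ({b, π b} : Finset α) d = π b := by
    rw [mxD_eq ⟨b, by simp⟩]
    refine le_antisymm (Finset.max'_le _ _ _ fun z hz => ?_) (Finset.le_max' _ _ (by simp))
    simp only [Finset.mem_insert, Finset.mem_singleton] at hz; rcases hz with rfl | rfl; exacts [hp.2.1.le, le_rfl]
  have hdA : dA (toCfg (π, a, b)) d = a := ha
  have hdA' : dA' (toCfg (π, a, b)) d = π a := by unfold dA'; rw [hP, hmx1]
  have hdB : dB (toCfg (π, a, b)) d = b := by unfold dB; rw [hN, hmn2]
  have hdB' : dB' (toCfg (π, a, b)) d = π b := by unfold dB'; rw [hN, hmx2]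
  unfold ofCfg
  simp only [hdA, hdA', hdB, hdB']
  refine Prod.ext (funext fun x => ?_) rfl
  show (if x = a then π a else if x = π a then a else if x = b then π b else if x = π b then b else (toCfg (π, a, b)).1 x) = π x
  by_cases hx : x ∈ quad π a b
  · rcases mem_quad.1 hx with rfl | rfl | rfl | rfl
    · simp
    · simp [Ne.symm d1, (hd a).1]
    · simp [d3.symm, d4]
    · simp [Ne.symm d5, Ne.symm d6, Ne.symm d2, (hd b).1]
  · rw [toCfg_fst_of_not_mem hx]
    rw [mem_quad] at hx; push Not at hx
    simp [hx.1, hx.2.1, hx.2.2.1, hx.2.2.2]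

/-- **One-defect structures and configurations of `dSet` are equinumerous.** [folklore] -/
theorem card_defectSet_eq_card_dSet (d : α) : (defectSet α).card = (dSet α).card := by
  refine Finset.card_nbij' toCfg (ofCfg d) ?_ ?_ ?_ ?_
  · intro t ht; rw [Finset.mem_coe] at ht; rw [Finset.mem_coe, mem_dSet]; exact isDCfg_toCfg ht
  · intro c hc; rw [Finset.mem_coe, mem_dSet] at hc; rw [Finset.mem_coe]; exact (ofCfg_mem d hc).1
  · intro t ht; rw [Finset.mem_coe] at ht; exact ofCfg_toCfg d ht
  · intro c hc; rw [Finset.mem_coe, mem_dSet] at hc; exact (ofCfg_mem d hc).2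

end Summit.CriticalPhenomena.PercolationContinuityZ3.Theorems.Pcint.ChordDiag
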